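import Mathlib.Analysis.SpecialFunctions.Pow.Real
import Literature.Computability.Cryptography.WordRAMProofs
import Literature.Computability.FineGrained.SETHHardness
import HarnessLib
import HarnessLib.Audit

/-!
# Randomised word-RAM SETH (`KSATInRAMTimeRand`, `SETHWordRAMRand`)

The Strong Exponential Time Hypothesis at its *printed strength* — for RANDOMISED algorithms — in
the machine model of fine-grained complexity, as the sibling of the deterministic word-RAM
hypothesis `Literature.Computability.FineGrained.SETHWordRAM` /
`Literature.Computability.FineGrained.KSATInRAMTime` of `SETHHardness.lean`, with the SAME machine
conventions (oracle-free `WordRAM.Program`, word size `k' * (n + width φ)` = `Θ(n)` bits, time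
bound `⌊C · 2^{δ n} + C⌋₊`, `n = numVars`), the coins being the uniform `w`-bit words delivered by
the `rand` instruction and success being measured by `WordRAM.successProb` exactly as in the
randomised running-time predicates `FGProblem.RandInTimeInst` / `RandInTime` (threshold `2/3`) of
`Literature.Computability.Cryptography.FGComplexity`.

Sources (quoted from the materialised pages):

* Calabro–Impagliazzo–Paturi, *The complexity of satisfiability of small depth circuits*,
  IWPEC 2009, LNCS 5917, §1.1 (PDF p. 3): "Let `s_k = inf{c | ∃ a randomized algorithm for k-SAT
  with time complexity poly(m)2^{cn} for k-CNF formulas of size m over n variables}`. […] [IP01]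
  proposed the open question whether `s_∞ = 1`, which we will call the Strongly Exponential-Time
  Hypothesis (SETH)." — `s_k` is an infimum over *randomised* algorithms.
* V. Vassilevska Williams, *Hardness of easy problems: basing hardness on popular conjectures such
  as the Strong Exponential Time Hypothesis*, IPEC 2015 (LIPIcs 43), §2 (p. 19): "we assume that we
  are working with a Word RAM model with `O(log n)` bit words"; §2.3, Conjecture 3 (SETH) (p. 20):
  "For every `ε > 0`, there exists an integer `k`, such that Satisfiability on `k`-CNF formulas on
  `n` variables cannot be solved in `O(2^{(1−ε)n} poly n)` time in expectation."
* V. Vassilevska Williams, *On some fine-grained questions in algorithms and complexity*,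
  Proc. ICM 2018, §2.1 "Key Hypotheses" of the author's version (PDF p. 4; the hypotheses section is
  cited as §3 of the published version elsewhere in this directory): "All hypotheses are about the
  word-RAM model of computation with `O(log n)` bit words, where `n` is the size of the input. […]
  At the time they only considered deterministic algorithms, but nowadays it is common to extend
  SETH to allow randomization. **Hypothesis 1 (SETH).** For every `ε > 0` there exists an integer
  `k ≥ 3` such that CNF-SAT on formulas with clause size at most `k` (the so called `k`-SAT problem)
  and `n` variables cannot be solved in `O(2^{(1−ε)n})` time even by a randomized algorithm."

Contents:

* `KSATInRAMTimeRand k δ` — `k`-SAT is solvable by a randomised oracle-free word-RAM program with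
  success probability `≥ 2/3` within `⌊C · 2^{δ n} + C⌋₊` steps (`Θ(n)`-bit words);
* `SETHWordRAMRand` — OPEN CONJECTURE, `∀ ε > 0, ∃ k ≥ 3, ¬ KSATInRAMTimeRand k (1 - ε)`; a hypothesis
  only (`[status: open]`), never discharged;
* API: `sethWordRAMRand_def` (the body spelled out, `Iff.rfl` — the form inlined by consumers),
  `KSATInRAMTimeRand.mono` (in `δ`), `KSATInRAMTimeRand.anti` (in `k`), `sethWordRAMRand_iff`
  (the side condition `3 ≤ k` is immaterial), `kSATInRAMTimeRand_of_kSATInRAMTime` (a deterministic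
  algorithm is a randomised one, via `successProb_eq_one_iff_of_isDeterministic_holds`) and
  `sethWordRAM_of_sethWordRAMRand : SETHWordRAMRand → SETHWordRAM` (randomised SETH is the
  stronger hypothesis).

## Mathlib

Mathlib has no random-access machines, no randomised time classes and no SETH (searched `SETH`,
`RandomAccess`, `BPTIME`, `successProb`: no relevant hits; only `Turing.TM0/TM1/TM2`). Used from
Mathlib: `Real.rpow`, `Nat.floor`.

## Design choices

* **Same conventions as `KSATInRAMTime`.** Word size `k' * (numVars φ + width φ)` (`Θ(n)` bits, so
  that the `2^{Θ(n)}` cells used by exponential-time SAT algorithms and by the SAT → OV /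
  `k`-Dominating-Set reductions are addressable, see the "Machine models" bullet of
  `SETHHardness.lean`), the `poly(L)` factor dropped (`L = n^{O(k)} = 2^{o(n)}` for `kSATProblem k`
  and SETH quantifies over every saving `ε`), time bound `⌊C · 2^{δ n} + C⌋₊`. Only the two
  deterministic clauses change: `M.IsDeterministic` is dropped and "`∃ out ∈ Good φ, OutputsWithin
  … zeroCoins … out t`" becomes "`2/3 ≤ successProb M w noOracle (encode φ) (Good φ) t`".
* **Error model.** `successProb M w O x S t` is the probability, over `t` independent uniform
  `w`-bit coin words, that `M` halts within `t` steps with output in `S`; `kSATProblem k` is a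
  decision problem (`Good φ = {[1]}` or `{[0]}`), so `KSATInRAMTimeRand` asks for a bounded-error
  (two-sided, Monte Carlo) algorithm with a worst-case time bound — the reading of "solved by a
  randomised algorithm in time `T`" used by `FGProblem.RandInTime` (VVW ICM 2018, §2) and the
  weakest of the printed requirements on the algorithm, hence the strongest form of the
  hypothesis's conclusion `¬ KSATInRAMTimeRand k (1 - ε)`. An expected-time (`in expectation`,
  IPEC 2015) or one-sided-error algorithm with the same exponent yields one in this sense after
  truncation at three times its expected running time (Markov), the constant being absorbed by `C`;
  the threshold `2/3` is the customary one (any constant in `(1/2, 1)` gives the same hypothesis up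
  to `O(1)` independent repetitions and a majority vote — standard amplification, not formalised
  here).
* `3 ≤ k` as in ICM 2018, Hypothesis 1 and in `SETHWordRAM`; IPEC 2015, Conj. 3 has a bare
  "integer `k`" — immaterial by antitonicity in `k` (`sethWordRAMRand_iff`).
* What is NOT here: no `SETHWordRAMRand_holds` (an open conjecture; it implies `SETHWordRAM`, hence
  Turing-machine `SETH`, hence `P ≠ NP`); no equivalence with an `O(log L)`-bit-word variant; no
  amplification lemma; no randomised hardness consequences (OV, edit distance, …) — those are
  separate statements to be vendored at printed strength on top of this hypothesis.
-/

namespace Literature.Computability.FineGrained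

open Cryptography Cryptography.WordRAM

/-! ### Randomised `k`-SAT algorithms on the word RAM -/

/-- `KSATInRAMTimeRand k δ`: `k`-SAT (the accepted `kSATProblem k`: width `≤ k`, no repeated
clause, size `n = numVars`) is solvable on the RANDOMISED word RAM in time `O(2^{δ n})` with
bounded error: some oracle-free program `M` (which may use the `rand` instruction, i.e. uniform
`w`-bit coin words), run with word size `w = k' * (n + width φ)` (`Θ(n)`-bit words, exactly as in
the deterministic `KSATInRAMTime`), halts with the accepted answer (`[1]` if `φ` is satisfiable,
`[0]` otherwise) within `⌊C · 2^{δ n} + C⌋₊` steps with probability at least `2/3` on every instance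
`φ` (`WordRAM.successProb`, the convention of `FGProblem.RandInTimeInst … (2/3)`). This is the
class of algorithms over which Calabro–Impagliazzo–Paturi take the infimum defining `s_k`
(IWPEC 2009, §1.1, p. 3: "`s_k = inf{c | ∃ a randomized algorithm for k-SAT with time complexity
poly(m)2^{cn} …}`"), in the word-RAM model of VVW IPEC 2015, §2 / ICM 2018, §2.1; the `poly(m)`
factor is dropped as in `KSATInRAMTime` (immaterial under `∀ ε`).
[cite: CalabroImpagliazzoPaturiIWPEC2009, §1.1 (p. 3: s_k over randomized algorithms)] -/
def KSATInRAMTimeRand (k : ℕ) (δ : ℝ) : Prop :=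
  ∃ (M : Program) (k' : ℕ) (C : ℝ), M.IsOracleFree ∧
    ∀ φ : (kSATProblem k).Inst, (2 / 3 : ℝ) ≤
      successProb M (k' * ((kSATProblem k).size φ + (kSATProblem k).width φ)) noOracle
        ((kSATProblem k).encode φ) ((kSATProblem k).Good φ)
        ⌊C * (2 : ℝ) ^ (δ * ((kSATProblem k).size φ : ℝ)) + C⌋₊

/-- OPEN CONJECTURE — **randomised word-RAM SETH**, the Strong Exponential Time Hypothesis at its
printed strength. V. Vassilevska Williams, Proc. ICM 2018, Hypothesis 1 (author's version §2.1,
p. 4): "For every `ε > 0` there exists an integer `k ≥ 3` such that CNF-SAT on formulas with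
clause size at most `k` (the so called `k`-SAT problem) and `n` variables cannot be solved in
`O(2^{(1−ε)n})` time even by a randomized algorithm", all hypotheses being "about the word-RAM
model of computation"; the same conjecture is VVW IPEC 2015, §2.3, Conj. 3 ("cannot be solved in
`O(2^{(1−ε)n} poly n)` time in expectation") and the `s_∞ = 1` question of
Calabro–Impagliazzo–Paturi, IWPEC 2009, §1.1 with `s_k` over randomised algorithms.
[status: open] — a registered open statement, used only as a hypothesis `(h : SETHWordRAMRand)`;
there is deliberately no `SETHWordRAMRand_holds` (it implies `SETHWordRAM`,
`sethWordRAM_of_sethWordRAMRand`, hence Turing-machine `SETH` and `P ≠ NP`).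

Statement: for every `ε > 0` there is `k ≥ 3` such that `k`-SAT on `n` variables has no
randomised word-RAM algorithm with `Θ(n)`-bit words succeeding with probability `≥ 2/3` within
`O(2^{(1-ε) n})` steps (`KSATInRAMTimeRand`). The side condition `3 ≤ k` is immaterial
(`sethWordRAMRand_iff`); the body with `KSATInRAMTimeRand` unfolded is `sethWordRAMRand_def`.
[cite: VassilevskaWilliamsICM2018, Hypothesis 1 (SETH; author's version §2.1, p. 4)] -/
@[conjecture] def SETHWordRAMRand : Prop :=
  ∀ ε : ℝ, 0 < ε → ∃ k : ℕ, 3 ≤ k ∧ ¬ KSATInRAMTimeRand k (1 - ε)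

/-! ### API -/

/-- `SETHWordRAMRand` with `KSATInRAMTimeRand` unfolded — the form in which consumers inline the
hypothesis (definitional, `Iff.rfl`). [folklore] -/
theorem sethWordRAMRand_def :
    SETHWordRAMRand ↔
      ∀ ε : ℝ, 0 < ε → ∃ k : ℕ, 3 ≤ k ∧ ¬ ∃ (M : Program) (k' : ℕ) (C : ℝ), M.IsOracleFree ∧
        ∀ φ : (kSATProblem k).Inst, (2 / 3 : ℝ) ≤
          successProb M (k' * ((kSATProblem k).size φ + (kSATProblem k).width φ)) noOracle
            ((kSATProblem k).encode φ) ((kSATProblem k).Good φ)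
            ⌊C * (2 : ℝ) ^ ((1 - ε) * ((kSATProblem k).size φ : ℝ)) + C⌋₊ :=
  Iff.rfl

/-- Monotonicity of `KSATInRAMTimeRand` in the exponent: a larger step budget can only increase the
success probability (`WordRAM.successProb_mono_steps`). [folklore] -/
theorem KSATInRAMTimeRand.mono {k : ℕ} {δ δ' : ℝ} (h : KSATInRAMTimeRand k δ) (hδ : δ ≤ δ') :
    KSATInRAMTimeRand k δ' := by
  obtain ⟨M, k', C, hof, hM⟩ := h
  refine ⟨M, k', max C 0, hof, fun φ =>
    (hM φ).trans (successProb_mono_steps _ _ _ _ _ (Nat.floor_le_floor ?_))⟩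
  have h1 : (0 : ℝ) ≤ (2 : ℝ) ^ (δ * ((kSATProblem k).size φ : ℝ)) := by positivity
  have h2 : (2 : ℝ) ^ (δ * ((kSATProblem k).size φ : ℝ)) ≤
      (2 : ℝ) ^ (δ' * ((kSATProblem k).size φ : ℝ)) :=
    Real.rpow_le_rpow_of_exponent_le (by norm_num)
      (mul_le_mul_of_nonneg_right hδ (Nat.cast_nonneg _))
  calc C * (2 : ℝ) ^ (δ * ((kSATProblem k).size φ : ℝ)) + C
      ≤ max C 0 * (2 : ℝ) ^ (δ * ((kSATProblem k).size φ : ℝ)) + max C 0 :=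
        add_le_add (mul_le_mul_of_nonneg_right (le_max_left _ _) h1) (le_max_left _ _)
    _ ≤ max C 0 * (2 : ℝ) ^ (δ' * ((kSATProblem k).size φ : ℝ)) + max C 0 := by
        gcongr

/-- A randomised algorithm for `k'`-SAT is one for `k`-SAT when `k ≤ k'` (`kSATProblem k` and
`kSATProblem k'` are restrictions of the same `CNFSAT`: same encoding, size, width and accepted
outputs), so `KSATInRAMTimeRand k δ` is antitone in `k` — the randomised counterpart of
`KSATInRAMTime.anti` and of the monotonicity of `s_k` in `k` (Impagliazzo–Paturi, JCSS 62 (2001),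
§1). [folklore] -/
theorem KSATInRAMTimeRand.anti {k k' : ℕ} {δ : ℝ} (h : KSATInRAMTimeRand k' δ) (hk : k ≤ k') :
    KSATInRAMTimeRand k δ := by
  obtain ⟨M, c, C, hof, hM⟩ := h
  refine ⟨M, c, C, hof, fun φ => ?_⟩
  have hφ : φ.1 ∈ {ψ : Literature.Computability.Complexity.CNF ℕ |
      Literature.Computability.Complexity.CNF.IsWidthLE k' ψ ∧ List.Nodup ψ} :=
    ⟨fun cl hcl => (φ.2.1 cl hcl).trans hk, φ.2.2⟩
  exact hM ⟨φ.1, hφ⟩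

/-- The side condition `3 ≤ k` in `SETHWordRAMRand` is immaterial (if `k` works, so does `max k 3`,
by `KSATInRAMTimeRand.anti`): randomised word-RAM SETH reads literally as `s_∞ = 1` with `s_k`
over randomised algorithms (Calabro–Impagliazzo–Paturi, IWPEC 2009, §1.1), and as VVW IPEC 2015,
Conj. 3 (bare "integer `k`"). [folklore] -/
theorem sethWordRAMRand_iff :
    SETHWordRAMRand ↔ ∀ ε : ℝ, 0 < ε → ∃ k : ℕ, ¬ KSATInRAMTimeRand k (1 - ε) := by
  refine ⟨fun h ε hε => ?_, fun h ε hε => ?_⟩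
  · obtain ⟨k, -, hk⟩ := h ε hε
    exact ⟨k, hk⟩
  · obtain ⟨k, hk⟩ := h ε hε
    exact ⟨max k 3, le_max_right _ _, fun h' => hk (h'.anti (le_max_left _ _))⟩

/-- A deterministic word-RAM algorithm is a randomised one with success probability `1 ≥ 2/3`
(`WordRAM.successProb_eq_one_iff_of_isDeterministic_holds`): `KSATInRAMTime k δ` implies
`KSATInRAMTimeRand k δ` with the same program, word size and constants. VVW ICM 2018, §2.1 ("it is
common to extend SETH to allow randomization"). [folklore] -/
theorem kSATInRAMTimeRand_of_kSATInRAMTime {k : ℕ} {δ : ℝ} (h : KSATInRAMTime k δ) :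
    KSATInRAMTimeRand k δ := by
  obtain ⟨M, k', C, hdet, hof, hM⟩ := h
  refine ⟨M, k', C, hof, fun φ => ?_⟩
  rw [(successProb_eq_one_iff_of_isDeterministic_holds hdet _ _ _ _ _).2 (hM φ)]
  norm_num

/-- Randomised word-RAM SETH implies the deterministic word-RAM SETH of `SETHHardness.lean`
(contrapositive of `kSATInRAMTimeRand_of_kSATInRAMTime`): the randomised hypothesis is the
stronger one, as noted in the docstrings of `SETHWordRAM` and of Wave0's `SETH`. [folklore] -/
theorem sethWordRAM_of_sethWordRAMRand (h : SETHWordRAMRand) : SETHWordRAM := by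
  intro ε hε
  obtain ⟨k, hk, hnot⟩ := h ε hε
  exact ⟨k, hk, fun hdet => hnot (kSATInRAMTimeRand_of_kSATInRAMTime hdet)⟩

end Literature.Computability.FineGrained
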